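import Literature.NumberTheory.GelbartRogawski1991.CompatibleSplitting
import HarnessLib

/-!
# Compatible splittings are stable under central twists trivial on the rational points

The "if" direction of [GelbartRogawski1991, Remark p. 457 L4–13] ("If `s*` is any other compatible splitting,
then `s* = s ⊗ ν′` where `ν′` is an automorphic character with values in the central subgroup `ℂ*`"; the
"only if" direction is the tree's `SplittingDatum.IsCompatible.exists_central_twist`), KERNEL and for any
abstract `SplittingDatum`: if `s` is compatible and `s′(g) = ν(g) · s(g)` for a map `ν : G(𝐀) → Mp` with
`π ∘ ν = 1` and `ν|_{G(F)} = 1`, then `s′` is compatible.  With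
`ν := Weil1964.adelicMpCont.ofScalar ∘ η` this is the compatibility of the normalised splitting
`Weil1964.adelicMpCont.twist s η` (`proj_ofScalar`, `twist_apply`) as soon as the character `η` is trivial on the
rational points — the form in which the `K_∞`-type normalisation of a Gelbart–Rogawski splitting
(`UnitaryGroupArchIsotropyTwist`) keeps Proposition 3.1.1's conclusion.

* `IsCompatible.of_central_twist` — the statement above (left twist `ν · s`);
* `IsCompatible.of_central_twist_right` — the same for `s · ν`;
* `IsCompatible.proj_twist_eq_one` — conversely, the quotient `s(g)⁻¹ s′(g)` of two compatible splittings lies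
  in `ker π` (pointwise form of `exists_central_twist`, no centrality needed).

Kernel only; 0 records.
-/

namespace Literature.NumberTheory.GelbartRogawski1991

namespace SplittingDatum

universe u v w

variable {Sp : Type u} {Mp : Type v} {GA : Type w} [Group Sp] [Group Mp] [Group GA]
variable {D : SplittingDatum Sp Mp GA}

/-- **Central twists trivial on `G(F)` preserve compatibility** ([GelbartRogawski1991, Remark p. 457], "if"
direction): `π (ν g) = 1` for all `g` and `ν γ = 1` on `G(F)` imply that `g ↦ ν g · s g` (assumed to be a
homomorphism `s′`) is compatible whenever `s` is. [cite: GelbartRogawski1991, §3.1 Remark p. 457 L4–13] -/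
theorem IsCompatible.of_central_twist {s s' : GA →* Mp} (hs : D.IsCompatible s) (ν : GA → Mp)
    (hν : ∀ g : GA, D.proj (ν g) = 1) (hs' : ∀ g : GA, s' g = ν g * s g)
    (hrat : ∀ γ ∈ D.ratPts, ν γ = 1) : D.IsCompatible s' := by
  refine ⟨fun g => ?_, fun γ hγ => ?_⟩
  · rw [hs', map_mul, hν, one_mul, hs.1]
  · rw [hs', hrat γ hγ, one_mul]
    exact hs.2 γ hγ

/-- The same for a right twist `s′(g) = s(g) · ν(g)` (the spelling of `exists_central_twist`). [folklore] -/
theorem IsCompatible.of_central_twist_right {s s' : GA →* Mp} (hs : D.IsCompatible s) (ν : GA → Mp)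
    (hν : ∀ g : GA, D.proj (ν g) = 1) (hs' : ∀ g : GA, s' g = s g * ν g)
    (hrat : ∀ γ ∈ D.ratPts, ν γ = 1) : D.IsCompatible s' := by
  refine ⟨fun g => ?_, fun γ hγ => ?_⟩
  · rw [hs', map_mul, hν, mul_one, hs.1]
  · rw [hs', hrat γ hγ, mul_one]
    exact hs.2 γ hγ

/-- Two compatible splittings differ pointwise by an element of `ker π`. [folklore] -/
theorem IsCompatible.proj_twist_eq_one {s s' : GA →* Mp} (hs : D.IsCompatible s) (hs' : D.IsCompatible s')
    (g : GA) : D.proj ((s g)⁻¹ * s' g) = 1 := by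
  rw [map_mul, map_inv, hs.1, hs'.1, inv_mul_cancel]

/-- … and agree on the rational points modulo the choice inside `i(Sp_F(W))`: both values are
`i (ι γ)`. [folklore] -/
theorem IsCompatible.apply_eq_of_mem_ratPts {s s' : GA →* Mp} (hs : D.IsCompatible s)
    (hs' : D.IsCompatible s') {γ : GA} (hγ : γ ∈ D.ratPts) : s' γ = s γ := by
  rw [hs.apply_eq_ratSplit hγ, hs'.apply_eq_ratSplit hγ]

end SplittingDatum

end Literature.NumberTheory.GelbartRogawski1991
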